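import Summits.BirchSwinnertonDyer.BirchSwinnertonDyer.Theses.LeadingTerm
import Summits.BirchSwinnertonDyer.BirchSwinnertonDyer.Theorems.LeadingTermLBOfCruxes
import HarnessLib

/-!
# BirchSwinnertonDyer / LeadingTerm — crux `SqueezeUBR2` (stmt-BirchSwinnertonDyer-0145),
# line `Sketch`, stub **TR** `stub_squeezeUB_transport`

Registered stub **TR** (transport) of the skeleton `Cruxes/SqueezeUBR2/Lines/Sketch.lean`
(crux `Summit.BirchSwinnertonDyer.BirchSwinnertonDyer.Theses.LeadingTerm.SqueezeUBR2`, byte-identical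
with `…Theses.Squeeze.SqueezeUB`: no excess rank, `rank_ℤ E(ℚ) ≤ ord_{s=1} L(E,s)`): the
Mordell–Weil rank and the analytic rank of an elliptic curve `E/ℚ` given by a Weierstrass equation
`W` are invariant under an admissible change of variables `C`,
`(C • W).mordellWeilRank = W.mordellWeilRank ∧ (C • W).analyticRank = W.analyticRank`.
This reduces the crux to globally minimal Weierstrass models (`squeezeUBR2_of_isGloballyMinimal`
in the skeleton, via `WeierstrassCurve.hasGlobalMinimalModel_rat_holds`).

Proof — the (T1)–(T3) block of the certified deciding theorems
`Summit.BirchSwinnertonDyer.BirchSwinnertonDyer.Theses.LeadingTerm.closes` /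
`…Theses.PAdicOrderV2.closes` / `…Theses.SelmerRank.closes`, REUSED from the landed support file
`Theorems/LeadingTermLBOfCruxes.lean` (route LeadingTerm, item `LBOfCruxes`), where that block is
already split into named helpers:

* (T1) `leadingTerm_mordellWeilRank_smul`: `C` induces a group isomorphism `(C • W)(ℚ) ≃+ W(ℚ)`, so
  the `ℤ`-ranks agree (`WeierstrassCurve.VariableChange.finrank_point_variableChange`,
  Silverman *AEC* III.3.1(b)).
* (T2) `leadingTerm_localEulerFactor_smul`: over the fraction field `K` of a DVR `R`, the local Euler
  factor is computed on a local minimal model, and two minimal models of isomorphic curves differ by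
  a change of variables `D` (`exists_isMinimal`; *AEC* VII.1.3(b)); `D` preserves `v(Δ)` of minimal
  models (`valuation_Δ_eq_of_isMinimal_of_eq_smul`), hence good reduction, the reduction type
  (`hasSplitMultiplicativeReduction_iff_of_isMinimal_of_eq_smul`,
  `hasMultiplicativeReduction_iff_of_isMinimal_of_eq_smul`; *AEC* VII.5.1) and the number of points
  of the reduced curve (`exists_reduction_eq_smul`, `natCard_point_smul`), so the local polynomial
  and the local Euler factor agree (*AEC* App. C §16).
* (T3) `leadingTerm_entireLFunction_smul`, and `stubTR_analyticRank_smul` below: the global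
  `L`-function is the Euler product of the local factors at the finite places, so
  `L(C • W, s) = L(W, s)`, the entire continuation and `ord_{s=1}` agree.

Import cone: `Theses.LeadingTerm` (+ `Theorems.LeadingTermLBOfCruxes`, whose only import is
`Theses.LeadingTerm`) + `HarnessLib` — no `BSDInvariantsProofs` / `LFunctionSmulProofs`, whose
`analyticRank_variableChange_holds` would drag the unproved `RootNumber` facts into the cone.
-/

set_option linter.dupNamespace false

namespace Summit.BirchSwinnertonDyer.BirchSwinnertonDyer.Theorems

open WeierstrassCurve

/-- (T3) The analytic rank `ord_{s=1} L(E,s)` of an elliptic curve over `ℚ` is invariant under an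
admissible change of variables `C`: the entire `L`-function is (`leadingTerm_entireLFunction_smul`,
from the invariance of every local Euler factor, `leadingTerm_localEulerFactor_smul`).
[cite: SilvermanAEC2009, VII.1.3(b) and App. C §16] -/
theorem stubTR_analyticRank_smul (W : WeierstrassCurve ℚ) [W.IsElliptic]
    (C : WeierstrassCurve.VariableChange ℚ) : (C • W).analyticRank = W.analyticRank := by
  simp only [WeierstrassCurve.analyticRank, leadingTerm_entireLFunction_smul W C]

/-- Stub **TR** (transport) of line `Sketch` for the crux `SqueezeUBR2` (no excess rank): the
Mordell–Weil rank `rank_ℤ E(ℚ)` and the analytic rank `ord_{s=1} L(E,s)` of an elliptic curve over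
`ℚ` are invariant under an admissible change of variables `C` of its Weierstrass equation. Rank:
`C` is a group isomorphism on rational points (Silverman *AEC* III.3.1(b),
`VariableChange.finrank_point_variableChange`, as `leadingTerm_mordellWeilRank_smul`). Analytic
rank: every local Euler factor is computed on a local minimal model, unique up to
`u ∈ Rˣ, r s t ∈ R` (*AEC* VII.1.3(b), VII.2), which preserves the reduction type and the point
count of the reduction, hence `L(E,s)` and `ord_{s=1}` (*AEC* App. C §16;
`leadingTerm_localEulerFactor_smul`, `leadingTerm_entireLFunction_smul`, `stubTR_analyticRank_smul`)
— the (T1)–(T3) block of the certified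
`Summit.BirchSwinnertonDyer.BirchSwinnertonDyer.Theses.PAdicOrderV2.closes`.
[cite: SilvermanAEC2009, III.3.1(b) and App. C §16] -/
theorem stub_squeezeUB_transport :
    ∀ (W : WeierstrassCurve ℚ) [W.IsElliptic] (C : WeierstrassCurve.VariableChange ℚ),
      (C • W).mordellWeilRank = W.mordellWeilRank ∧ (C • W).analyticRank = W.analyticRank := by
  intro W _ C
  exact ⟨leadingTerm_mordellWeilRank_smul W C, stubTR_analyticRank_smul W C⟩

end Summit.BirchSwinnertonDyer.BirchSwinnertonDyer.Theorems
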